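import Summits.CriticalPhenomena.SAWScalingLimit.Theorems.SAWLoopFugacityFlowSimpleSubseqLimitsPSStubDecompositionCore
import HarnessLib

/-!
# Line `past-shadowing-costs-halves` (crux `SAWLoopFugacityFlow.SimpleSubseqLimits`, stmt-CriticalPhenomena-4982),
stub `stub_decomposition` — part 3: the registered stub

`stub_decomposition : RootReturn → SlitShadowDecay → PolylineShadowDecay` (reshaped skeleton
`Cruxes/SimpleSubseqLimits/Lines/past_shadowing_costs_halves.lean`, lead prover c1): the ROOT-FREE
DECOMPOSITION of the line. Off the root-return event every walk has a last exit index `k` from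
`B̄(a, ρ₀)` with its prefix inside `B(a, r₀)` (`LastExitAt`); by the deterministic core (part 2) and
the dyadic clock (part 1) an `ε`-near shadowing of an `η`-stretch by the whole polyline is an
`ε`-near shadowing of an `η/4`-stretch by the polyline of the REMAINING walk; and the slit bound takes over.
The vocabulary (`RootReturns`, `LastExitAt`, `suffixCurve`, `latticeCurve`,
`RootReturn`, `SlitShadowDecay`, `PolylineShadowDecay`) is VERBATIM the skeleton's; `NearShadows` is
the verbatim copy of part 2 (`Core.NearShadows`).
-/

noncomputable section

open MeasureTheory Filter Topology Set Metric
open scoped ENNReal NNReal unitInterval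

namespace Summit.CriticalPhenomena.SAWScalingLimit.Theorems.SimpleSubseqLimits.PastShadowing.Decomposition

open Literature.Probability.RandomPlanarGeometry Literature.Probability.RandomPlanarGeometry.SAW
open Literature.Probability.LatticeModels
open Summit.CriticalPhenomena.SAWScalingLimit.Theorems.SimpleSubseqLimits.PastShadowing.Clock
open Summit.CriticalPhenomena.SAWScalingLimit.Theorems.SimpleSubseqLimits.PastShadowing.Core
open Literature.Probability.RandomPlanarGeometry (dyadicTime)

/-! ## Vocabulary (verbatim the registered skeleton) -/

section Lattice

variable {Ω : Set ℂ} {δ : ℝ} {u v : Site 2}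

/-- **Root return** (vertex level): a vertex at distance `≥ r` from `c` followed LATER by a vertex
at distance `≤ ρ₀` from `c`. [folklore] -/
def RootReturns (γ : DomainSAW Ω δ u v) (c : ℂ) (ρ₀ r : ℝ) : Prop :=
  ∃ i j : ℕ, i < j ∧ j ≤ γ.length ∧ r ≤ dist (meshPoint δ (γ.walk.getVert i)) c ∧
    dist (meshPoint δ (γ.walk.getVert j)) c ≤ ρ₀

/-- **Last exit from `B̄(c, ρ₀)` at index `k`, with a microscopic prefix.** [folklore] -/
def LastExitAt (γ : DomainSAW Ω δ u v) (c : ℂ) (ρ₀ r₀ : ℝ) (k : ℕ) : Prop :=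
  k ≤ γ.length ∧ dist (meshPoint δ (γ.walk.getVert k)) c ≤ ρ₀ ∧
    (∀ j : ℕ, k < j → j ≤ γ.length → ρ₀ < dist (meshPoint δ (γ.walk.getVert j)) c) ∧
    ∀ i : ℕ, i ≤ k → dist (meshPoint δ (γ.walk.getVert i)) c < r₀

/-- The polyline of the REMAINING walk after `k` steps. [folklore] -/
def suffixCurve (γ : DomainSAW Ω δ u v) (k : ℕ) : Curve ℂ :=
  ⟨(γ.walk.drop k).toCurve (meshPoint δ)⟩

/-- The polyline of the whole walk (the canonical representative of `γ.curve`). [folklore] -/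
def latticeCurve (γ : DomainSAW Ω δ u v) : Curve ℂ :=
  ⟨γ.walk.toCurve (meshPoint δ)⟩

end Lattice

/-- **ROOT RETURN DECAY** (verbatim the skeleton's `RootReturn`; the line's root-side lattice INPUT,
an open statement of this crux line — deliberately untagged). -/
def RootReturn : Prop :=
  ∀ (D : DobrushinDomain) (a b : ℝ → Site 2), IsEndpointApprox D a b →
    ∀ r θ : ℝ, 0 < r → 0 < θ → ∃ ρ₀ : ℝ, 0 < ρ₀ ∧ ρ₀ < r ∧
      ∀ᶠ δ in 𝓝[>] (0 : ℝ),
        law D.carrier δ (a δ) (b δ) {γ | RootReturns γ (D.pt 0) ρ₀ r} ≤ ENNReal.ofReal θ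

/-- **SLIT SHADOW DECAY** (verbatim the skeleton's `SlitShadowDecay`; the line's G-type lattice INPUT,
an open statement of this crux line — deliberately untagged). -/
def SlitShadowDecay : Prop :=
  ∀ (D : DobrushinDomain) (a b : ℝ → Site 2), IsEndpointApprox D a b →
    ∀ η ρ θ ρ₀ r₀ : ℝ, 0 < η → 0 < ρ → 0 < θ → 0 < ρ₀ → ρ₀ < r₀ → 64 * r₀ ≤ η →
      ∃ ε : ℝ, 0 < ε ∧ ∀ᶠ δ in 𝓝[>] (0 : ℝ),
        law D.carrier δ (a δ) (b δ)
            {γ | ∃ k : ℕ, LastExitAt γ (D.pt 0) ρ₀ r₀ k ∧ NearShadows (suffixCurve γ k) η ρ ε} ≤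
          ENNReal.ofReal θ

/-- **Polyline-level shadow decay** (verbatim the skeleton's `PolylineShadowDecay`; what the decomposition
delivers — deliberately untagged). -/
def PolylineShadowDecay : Prop :=
  ∀ (D : DobrushinDomain) (a b : ℝ → Site 2), IsEndpointApprox D a b →
    ∀ η ρ θ : ℝ, 0 < η → 0 < ρ → 0 < θ → ∃ ε : ℝ, 0 < ε ∧
      ∀ᶠ δ in 𝓝[>] (0 : ℝ),
        law D.carrier δ (a δ) (b δ) {γ | NearShadows (latticeCurve γ) η ρ ε} ≤ ENNReal.ofReal θ

/-! ## Reading the clock on SAW polylines -/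

section SAW

variable {Ω : Set ℂ} {δ : ℝ} {u v : Site 2}

/-- **The remaining walk's polyline is the whole polyline on `[T_k, 1]`**: for `k ≤ |γ|`,
`suffixCurve γ k τ = latticeCurve γ (1 - 2^{-k} + 2^{-k} τ)`. [folklore] -/
theorem suffixCurve_apply (γ : DomainSAW Ω δ u v) {k : ℕ} (hk : k ≤ γ.length) (τ : I) :
    suffixCurve γ k τ = latticeCurve γ ⟨_, dyadic_mem k τ⟩ := by
  change (γ.walk.drop k).toCurve (meshPoint δ) τ = γ.walk.toCurve (meshPoint δ) ⟨_, dyadic_mem k τ⟩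
  simp only [SimpleGraph.Walk.toCurve]
  rw [SimpleGraph.Walk.drop_support_eq_support_drop_min,
    min_eq_left (show k ≤ γ.walk.length from hk), List.map_drop,
    ← SimpleGraph.Walk.cons_tail_support γ.walk]
  have hlen : k ≤ (γ.walk.support.tail.map (meshPoint δ)).length := by
    rw [List.length_map, List.length_tail, SimpleGraph.Walk.length_support]
    exact hk
  rw [List.map_cons, polyline_dyadic_apply k _ _ hlen τ]

/-- **The prefix polyline stays in the ball of its vertices**: if the vertices `0, …, k` lie in the
open ball `B(c, r₀)` then so does the polyline up to time `dyadicTime k`. [folklore] -/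
theorem dist_latticeCurve_lt_of_le (γ : DomainSAW Ω δ u v) {k : ℕ} (hk : k ≤ γ.length) {c : ℂ}
    {r₀ : ℝ} (h : ∀ i : ℕ, i ≤ k → dist (meshPoint δ (γ.walk.getVert i)) c < r₀) :
    ∀ s : I, s ≤ dyadicTime k → dist (latticeCurve γ s) c < r₀ := by
  intro s hs
  change dist (γ.walk.toCurve (meshPoint δ) s) c < r₀
  simp only [SimpleGraph.Walk.toCurve]
  rw [← SimpleGraph.Walk.cons_tail_support γ.walk, List.map_cons]
  rw [← Metric.mem_ball]
  refine polyline_mem_of_le_dyadicTime (convex_ball c r₀) k _ _ (fun x hx => ?_) s hs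
  rw [← List.map_cons, SimpleGraph.Walk.cons_tail_support, ← List.map_take] at hx
  obtain ⟨y, hy, rfl⟩ := List.mem_map.1 hx
  obtain ⟨j, hj, rfl⟩ := List.getElem_of_mem hy
  rw [List.length_take] at hj
  have hjk : j ≤ k := Nat.lt_succ_iff.1 (lt_of_lt_of_le hj (min_le_left _ _))
  have hjl : j ≤ γ.walk.length := hjk.trans hk
  rw [List.getElem_take, ← SimpleGraph.Walk.getVert_eq_support_getElem _ hjl, Metric.mem_ball]
  exact h j hjk

end SAW

/-! ## The registered stub -/

/-- **STUB `stub_decomposition` of the line `past-shadowing-costs-halves`** (registered):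
`RootReturn → SlitShadowDecay → PolylineShadowDecay`. See the module docstring. [folklore] -/
theorem stub_decomposition : RootReturn → SlitShadowDecay → PolylineShadowDecay := by
  intro hRR hSSD D a b hab η ρ θ hη hρ hθ
  -- parameters
  set r₀ : ℝ := η / 256 with hr₀def
  have hr₀ : 0 < r₀ := by positivity
  obtain ⟨ρ₀, hρ₀, hρ₀r, hevRR⟩ := hRR D a b hab r₀ (θ / 2) hr₀ (by positivity)
  obtain ⟨ε₀, hε₀, hevSSD⟩ := hSSD D a b hab (η / 4) ρ (θ / 2) ρ₀ r₀ (by positivity) hρ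
    (by positivity) hρ₀ hρ₀r (by rw [hr₀def]; linarith)
  refine ⟨min ε₀ r₀, lt_min hε₀ hr₀, ?_⟩
  have hstart : ∀ᶠ δ in 𝓝[>] (0 : ℝ), dist (meshPoint δ (a δ)) (D.pt 0) < ρ₀ :=
    (Metric.tendsto_nhds.1 hab.tendsto_fst) ρ₀ hρ₀
  filter_upwards [hevRR, hevSSD, hstart] with δ hδRR hδSSD hδstart
  set c : ℂ := D.pt 0 with hc
  set ε : ℝ := min ε₀ r₀ with hεdef
  have hε : 0 < ε := lt_min hε₀ hr₀
  have hεr : r₀ + ε < η / 4 := by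
    have : ε ≤ r₀ := min_le_right _ _
    rw [hr₀def] at this ⊢; linarith
  -- the pointwise inclusion
  have hincl : {γ : DomainSAW D.carrier δ (a δ) (b δ) | NearShadows (latticeCurve γ) η ρ ε} ⊆
      {γ | RootReturns γ c ρ₀ r₀} ∪
        {γ | ∃ k : ℕ, LastExitAt γ c ρ₀ r₀ k ∧ NearShadows (suffixCurve γ k) (η / 4) ρ ε₀} := by
    intro γ hγ
    by_cases hR : RootReturns γ c ρ₀ r₀
    · exact Or.inl hR
    refine Or.inr ?_
    classical
    -- the last exit index
    set F : Finset ℕ := (Finset.range (γ.length + 1)).filter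
      (fun j => dist (meshPoint δ (γ.walk.getVert j)) c ≤ ρ₀) with hF
    have h0F : 0 ∈ F := by
      rw [hF, Finset.mem_filter]
      refine ⟨Finset.mem_range.2 (Nat.succ_pos _), ?_⟩
      rw [SimpleGraph.Walk.getVert_zero]
      exact hδstart.le
    have hFne : F.Nonempty := ⟨0, h0F⟩
    set k : ℕ := F.max' hFne with hkdef
    have hkF : k ∈ F := Finset.max'_mem F hFne
    rw [hF, Finset.mem_filter, Finset.mem_range] at hkF
    have hkl : k ≤ γ.length := Nat.lt_succ_iff.1 hkF.1
    have hLEA : LastExitAt γ c ρ₀ r₀ k := by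
      refine ⟨hkl, hkF.2, fun j hkj hjl => ?_, fun i hik => ?_⟩
      · by_contra hle
        push Not at hle
        have hjF : j ∈ F := by
          rw [hF, Finset.mem_filter]
          exact ⟨Finset.mem_range.2 (Nat.lt_succ_iff.2 hjl), hle⟩
        exact absurd (Finset.le_max' F j hjF) (by rw [← hkdef]; exact not_le.2 hkj)
      · by_contra hle
        push Not at hle
        rcases hik.lt_or_eq with hlt | heq
        · exact hR ⟨i, k, hlt, hkl, hle, hkF.2⟩
        · rw [heq] at hle
          linarith [hkF.2]
    refine ⟨k, hLEA, ?_⟩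
    -- the deterministic core and the clock
    have hpre := dist_latticeCurve_lt_of_le γ hkl hLEA.2.2.2
    have hfrom := nearShadowsFrom_of_prefix_ball hpre hε hεr hγ
    have hsuf : NearShadows (suffixCurve γ k) (η / 4) ρ ε :=
      nearShadows_of_comp_dyadic (fun τ => suffixCurve_apply γ hkl τ) hfrom
    -- monotonicity in `ε ≤ ε₀`
    obtain ⟨s₀, t, t', h1, h2, h3, h4⟩ := hsuf
    refine ⟨s₀, t, t', h1, h2, h3, fun w hw hw' => ?_⟩
    obtain ⟨x, hx, hρx, hdx⟩ := h4 w hw hw'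
    exact ⟨x, hx, hρx, hdx.trans_le (min_le_left _ _)⟩
  -- summing up
  calc law D.carrier δ (a δ) (b δ) {γ | NearShadows (latticeCurve γ) η ρ ε}
      ≤ law D.carrier δ (a δ) (b δ) ({γ | RootReturns γ c ρ₀ r₀} ∪
          {γ | ∃ k : ℕ, LastExitAt γ c ρ₀ r₀ k ∧ NearShadows (suffixCurve γ k) (η / 4) ρ ε₀}) :=
        measure_mono hincl
    _ ≤ law D.carrier δ (a δ) (b δ) {γ | RootReturns γ c ρ₀ r₀} +
          law D.carrier δ (a δ) (b δ)
            {γ | ∃ k : ℕ, LastExitAt γ c ρ₀ r₀ k ∧ NearShadows (suffixCurve γ k) (η / 4) ρ ε₀} :=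
        measure_union_le _ _
    _ ≤ ENNReal.ofReal (θ / 2) + ENNReal.ofReal (θ / 2) := add_le_add hδRR hδSSD
    _ = ENNReal.ofReal θ := by
        rw [← ENNReal.ofReal_add (by positivity) (by positivity), add_halves]

end Summit.CriticalPhenomena.SAWScalingLimit.Theorems.SimpleSubseqLimits.PastShadowing.Decomposition

end
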